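import Summits.QuantumFields.YangMills.Theorems.LangevinControlUVOSLegsFromFemtoAndGapStubCollar6
import Summits.QuantumFields.YangMills.Theorems.LangevinControlUVOSLegsFromFemtoAndGapStubCollar
import Literature.MathematicalPhysics.QuantumFieldTheory.QCDTorusTranslation
import Literature.MathematicalPhysics.QuantumFieldTheory.QCDTimeReflection
import Literature.Probability.LatticeModels.TorusCentredLift

/-!
# Route `UniversalDetector`, support item `PlaneLimitExtraction` (stmt-QuantumFields-23251) — torus periodicity,
box representatives and time-wrap exclusion

Ideator seat ym-idea-8 g7 (LINE 4 of rung R2a = `BalabanLadder.NT`).  Lattice-side inputs for the Riemann-sum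
passage in `PlaneLimitExtraction`: (TIGHT6)/(TIGHT) bound the rescaled truncated two-point kernels only at
arguments `z ∈ box 4 L`, whereas the pairs `(x, y)` charged by a Schwartz-weighted double sum have `y - x`
(and `ϑx - y`) anywhere in `box 4 (2L)`.  On the odd torus `2L+1` every kernel is `(2L+1)ℤ⁴`-periodic in its
site argument (`cov_dens_add_period`, `cov_plane_add_period`; the periodic lift is invariant under period
shifts, `configShift_period_torusLift`), so the argument may be replaced by its centred representative
`Torus.cRep (Torus.proj (2L+1) z) ∈ box 4 L` (`cRep_proj_mem_box`, `cov_dens_cRep`, `cov_plane_cRep`), which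
moreover keeps every coordinate already in the window `[-L, L]` (`cRep_proj_apply_of_mem`) — in particular the
TIME coordinate of a pair in two slabs of fixed physical heights once `aL` is large (time-wrap exclusion), so the
annulus condition `η ≤ ‖a • z‖` survives the reduction through `a|z₀| ≤ ‖a • z‖`
(`two_mul_le_norm_smul_reflect_sub`; cf. the landed `ResponseLocalisation.Far.mul_abs_coord_le_norm`).  `slab_window` converts physical slab
membership into the lattice window used by the mirror-positivity lemmas.  No summit, rung or crux is proved here.
-/

set_option autoImplicit false

noncomputable section

open MeasureTheory Filter Topology
open Literature.MathematicalPhysics.QuantumFieldTheory Literature.MathematicalPhysics.QuantumLattice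
  Literature.Probability.LatticeModels
open Summit.QuantumFields.YangMills.Cruxes.OSLegsFromFemtoAndGap.DlrCollarTransfer

namespace Summit.QuantumFields.YangMills.Cruxes.UniversalDetectorPlaneTight

variable {G : Type} [Group G] [TopologicalSpace G] [IsTopologicalGroup G] [CompactSpace G]
  [MeasurableSpace G] [BorelSpace G] (r : LatticeRep G)

/-! ## Periodicity of the lift and of the kernels -/

omit [IsTopologicalGroup G] [CompactSpace G] [BorelSpace G] in
/-- A period vector projects to `0` on the torus of side `2L+1`. -/
theorem torusProj_period_smul (L : ℕ) (v : Site 4) :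
    Torus.proj (2 * L + 1) ((((2 * L + 1 : ℕ) : ℤ)) • v) = 0 := by
  funext i
  rw [Torus.proj_apply, Pi.smul_apply, smul_eq_mul, Int.cast_mul, Int.cast_natCast, ZMod.natCast_self, zero_mul,
    Pi.zero_apply]

omit [Group G] [TopologicalSpace G] [IsTopologicalGroup G] [CompactSpace G] [BorelSpace G] in
/-- **The periodic lift is invariant under period translations.** -/
theorem configShift_period_torusLift (L : ℕ) (v : Site 4) (U : GaugeConfig 4 (2 * L + 1) G) :
    configShift ((((2 * L + 1 : ℕ) : ℤ)) • v) (torusLift (2 * L + 1) U) = torusLift (2 * L + 1) U := by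
  rw [configShift_torusLift, torusProj_period_smul]
  congr 1
  funext e
  rw [torusConfigShift_apply, sub_zero]

/-- The action density read on the lift is `(2L+1)ℤ⁴`-periodic in its site. -/
theorem dens_add_period_torusLift (L : ℕ) (z v : Site 4) (U : GaugeConfig 4 (2 * L + 1) G) :
    dens G r (z + (((2 * L + 1 : ℕ) : ℤ)) • v) (torusLift (2 * L + 1) U) = dens G r z (torusLift (2 * L + 1) U) := by
  unfold dens
  rw [neg_add, configShift_add', ← smul_neg, configShift_period_torusLift]

omit [IsTopologicalGroup G] [CompactSpace G] [BorelSpace G] in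
/-- A plane field read on the lift is `(2L+1)ℤ⁴`-periodic in its site. -/
theorem plane_add_period_torusLift (L : ℕ) (q : Fin 4 × Fin 4) (z v : Site 4) (U : GaugeConfig 4 (2 * L + 1) G) :
    plane G r q (z + (((2 * L + 1 : ℕ) : ℤ)) • v) (torusLift (2 * L + 1) U) =
      plane G r q z (torusLift (2 * L + 1) U) := by
  unfold plane
  rw [neg_add, configShift_add', ← smul_neg, configShift_period_torusLift]

/-- **Periodicity of the truncated two-point function of the density** in the second site. -/
theorem cov_dens_add_period (β : ℝ) (L : ℕ) (x z v : Site 4) :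
    torusE G r β L (fun V => dens G r x V * dens G r (z + (((2 * L + 1 : ℕ) : ℤ)) • v) V) -
        torusE G r β L (dens G r x) * torusE G r β L (dens G r (z + (((2 * L + 1 : ℕ) : ℤ)) • v)) =
      torusE G r β L (fun V => dens G r x V * dens G r z V) - torusE G r β L (dens G r x) * torusE G r β L (dens G r z) := by
  unfold torusE
  simp_rw [dens_add_period_torusLift]

/-- **Periodicity of the plane-resolved truncated two-point functions** in the second site. -/
theorem cov_plane_add_period (β : ℝ) (L : ℕ) (p q : Fin 4 × Fin 4) (x z v : Site 4) :
    torusE G r β L (fun V => plane G r p x V * plane G r q (z + (((2 * L + 1 : ℕ) : ℤ)) • v) V) -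
        torusE G r β L (plane G r p x) * torusE G r β L (plane G r q (z + (((2 * L + 1 : ℕ) : ℤ)) • v)) =
      torusE G r β L (fun V => plane G r p x V * plane G r q z V) -
        torusE G r β L (plane G r p x) * torusE G r β L (plane G r q z) := by
  unfold torusE
  simp_rw [plane_add_period_torusLift]

/-! ## Centred representatives in the box -/

omit [IsTopologicalGroup G] [CompactSpace G] [BorelSpace G] in
/-- Two sites with the same projection differ by a period vector. -/
theorem exists_eq_add_period_smul_of_proj_eq (L : ℕ) {z z' : Site 4}
    (h : Torus.proj (2 * L + 1) z' = Torus.proj (2 * L + 1) z) :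
    ∃ v : Site 4, z' = z + (((2 * L + 1 : ℕ) : ℤ)) • v := by
  have hk : ∀ i, ∃ k : ℤ, z' i = z i + ((2 * L + 1 : ℕ) : ℤ) * k := fun i => by
    have hi := congrFun h i
    rw [Torus.proj_apply, Torus.proj_apply, ZMod.intCast_eq_intCast_iff_dvd_sub] at hi
    obtain ⟨k, hk⟩ := hi
    exact ⟨-k, by linarith⟩
  choose k hk using hk
  refine ⟨k, funext fun i => ?_⟩
  rw [Pi.add_apply, Pi.smul_apply, smul_eq_mul]
  exact hk i

omit [IsTopologicalGroup G] [CompactSpace G] [BorelSpace G] in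
/-- **The centred representative lies in the box** `box 4 L` (torus of side `2L+1`). -/
theorem cRep_proj_mem_box (L : ℕ) (z : Site 4) : Torus.cRep (Torus.proj (2 * L + 1) z) ∈ box 4 L := by
  rw [mem_box]
  intro i
  have h := Torus.two_mul_cRepZ_bounds (L := 2 * L + 1) (Torus.proj (2 * L + 1) z i)
  show -(L : ℤ) ≤ Torus.cRepZ (Torus.proj (2 * L + 1) z i) ∧ Torus.cRepZ (Torus.proj (2 * L + 1) z i) ≤ L
  push_cast at h
  omega

omit [IsTopologicalGroup G] [CompactSpace G] [BorelSpace G] in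
/-- The centred representative has the same projection. -/
theorem proj_cRep_proj (L : ℕ) (z : Site 4) :
    Torus.proj (2 * L + 1) (Torus.cRep (Torus.proj (2 * L + 1) z)) = Torus.proj (2 * L + 1) z :=
  Torus.proj_cRep _

omit [IsTopologicalGroup G] [CompactSpace G] [BorelSpace G] in
/-- **Coordinates already in the window are kept**: if `-L ≤ z i ≤ L` then the centred representative has the
same `i`-th coordinate (time-wrap exclusion uses `i = 0`). -/
theorem cRep_proj_apply_of_mem (L : ℕ) (z : Site 4) (i : Fin 4) (hz : -(L : ℤ) ≤ z i ∧ z i ≤ L) :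
    Torus.cRep (Torus.proj (2 * L + 1) z) i = z i := by
  rcases Torus.sub_repr_dichotomy (L := 2 * L + 1) (z := Torus.cRep (Torus.proj (2 * L + 1) z) i) (w := z i)
    (by rw [Torus.cRep, Torus.intCast_cRepZ, Torus.proj_apply]) with h | h
  · exact h
  · exfalso
    have hb := (mem_box.1 (cRep_proj_mem_box L z)) i
    have h2 : |Torus.cRep (Torus.proj (2 * L + 1) z) i - z i| ≤ 2 * L := by
      rw [abs_le]; constructor <;> linarith [hb.1, hb.2, hz.1, hz.2]
    push_cast at h
    linarith

/-- **Kernel at the centred representative** (density): `Cov_T(dens x, dens (cRep z)) = Cov_T(dens x, dens z)`. -/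
theorem cov_dens_cRep (β : ℝ) (L : ℕ) (x z : Site 4) :
    torusE G r β L (fun V => dens G r x V * dens G r (Torus.cRep (Torus.proj (2 * L + 1) z)) V) -
        torusE G r β L (dens G r x) * torusE G r β L (dens G r (Torus.cRep (Torus.proj (2 * L + 1) z))) =
      torusE G r β L (fun V => dens G r x V * dens G r z V) - torusE G r β L (dens G r x) * torusE G r β L (dens G r z) := by
  obtain ⟨v, hv⟩ := exists_eq_add_period_smul_of_proj_eq L (proj_cRep_proj L z)
  rw [hv]
  exact cov_dens_add_period r β L x z v

/-- **Kernel at the centred representative** (planes). -/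
theorem cov_plane_cRep (β : ℝ) (L : ℕ) (p q : Fin 4 × Fin 4) (x z : Site 4) :
    torusE G r β L (fun V => plane G r p x V * plane G r q (Torus.cRep (Torus.proj (2 * L + 1) z)) V) -
        torusE G r β L (plane G r p x) * torusE G r β L (plane G r q (Torus.cRep (Torus.proj (2 * L + 1) z))) =
      torusE G r β L (fun V => plane G r p x V * plane G r q z V) -
        torusE G r β L (plane G r p x) * torusE G r β L (plane G r q z) := by
  obtain ⟨v, hv⟩ := exists_eq_add_period_smul_of_proj_eq L (proj_cRep_proj L z)
  rw [hv]
  exact cov_plane_add_period r β L p q x z v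

/-! ## Time-wrap exclusion: the annulus condition from the time coordinate -/

omit [IsTopologicalGroup G] [CompactSpace G] [BorelSpace G] in
/-- **Reflected pairs of a positive-time slab are `2t₀`-separated**, also after the one-unit electric time shift:
for lattice points `x, y` with `t₀ ≤ a x₀` and `t₀ ≤ a y₀` (`a > 0`),
`2t₀ ≤ ‖a(ϑx - y)‖` and `2t₀ ≤ ‖a(ϑx - e₀ - y)‖`. -/
theorem two_mul_le_norm_smul_reflect_sub {a t₀ : ℝ} (ha : 0 < a) {x y : Site 4}
    (hx : t₀ ≤ a * (x 0 : ℝ)) (hy : t₀ ≤ a * (y 0 : ℝ)) :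
    2 * t₀ ≤ ‖a • siteToE (siteReflect x - y)‖ ∧
      2 * t₀ ≤ ‖a • siteToE (siteReflect x - Pi.single 0 1 - y)‖ := by
  -- `a |z 0| ≤ ‖a • z‖` (the landed `ResponseLocalisation.Far.mul_abs_coord_le_norm`, re-derived in two lines to keep
  -- the import closure of this module inside the OS-legs toolkit)
  have key : ∀ z : Site 4, a * |(z 0 : ℝ)| ≤ ‖a • siteToE z‖ := fun z => by
    rw [norm_smul, Real.norm_of_nonneg ha.le]
    gcongr
    simpa [siteToE_apply, Real.norm_eq_abs] using PiLp.norm_apply_le (siteToE z) 0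
  constructor
  · refine le_trans ?_ (key (siteReflect x - y))
    have h0 : (((siteReflect x - y : Site 4) 0 : ℤ) : ℝ) = -(x 0 : ℝ) - (y 0 : ℝ) := by
      rw [Pi.sub_apply, siteReflect_apply_zero]; push_cast; ring
    rw [h0]
    have : a * (-(x 0 : ℝ) - (y 0 : ℝ)) ≤ a * |-(x 0 : ℝ) - (y 0 : ℝ)| :=
      mul_le_mul_of_nonneg_left (le_abs_self _) ha.le
    have h2 : a * |-(x 0 : ℝ) - (y 0 : ℝ)| = a * |(x 0 : ℝ) + (y 0 : ℝ)| := by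
      rw [show -(x 0 : ℝ) - (y 0 : ℝ) = -((x 0 : ℝ) + (y 0 : ℝ)) by ring, abs_neg]
    rw [h2]
    calc 2 * t₀ ≤ a * ((x 0 : ℝ) + (y 0 : ℝ)) := by linarith
      _ ≤ a * |(x 0 : ℝ) + (y 0 : ℝ)| := mul_le_mul_of_nonneg_left (le_abs_self _) ha.le
  · refine le_trans ?_ (key (siteReflect x - Pi.single 0 1 - y))
    have h0 : (((siteReflect x - Pi.single 0 1 - y : Site 4) 0 : ℤ) : ℝ) = -(x 0 : ℝ) - 1 - (y 0 : ℝ) := by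
      rw [Pi.sub_apply, Pi.sub_apply, siteReflect_apply_zero, Pi.single_eq_same]; push_cast; ring
    rw [h0]
    have h2 : a * |-(x 0 : ℝ) - 1 - (y 0 : ℝ)| = a * |(x 0 : ℝ) + 1 + (y 0 : ℝ)| := by
      rw [show -(x 0 : ℝ) - 1 - (y 0 : ℝ) = -((x 0 : ℝ) + 1 + (y 0 : ℝ)) by ring, abs_neg]
    rw [h2]
    calc 2 * t₀ ≤ a * ((x 0 : ℝ) + 1 + (y 0 : ℝ)) := by nlinarith
      _ ≤ a * |(x 0 : ℝ) + 1 + (y 0 : ℝ)| := mul_le_mul_of_nonneg_left (le_abs_self _) ha.le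

omit [IsTopologicalGroup G] [CompactSpace G] [BorelSpace G] in
/-- **Physical slab ⇒ lattice window.**  A lattice point of the slab `t₀ ≤ a x₀ ≤ T` (`0 < t₀`, `0 < a`) lies in
the window `0 ≤ x₀`, `x₀ + 2 ≤ L` of the mirror-positivity lemmas as soon as `T + 2a ≤ aL`. -/
theorem slab_window {a t₀ T : ℝ} (ha : 0 < a) (ht₀ : 0 < t₀) {L : ℕ} (hL : T + 2 * a ≤ a * L) {x : Site 4}
    (hx : t₀ ≤ a * (x 0 : ℝ)) (hx' : a * (x 0 : ℝ) ≤ T) : 0 ≤ x 0 ∧ x 0 + 2 ≤ (L : ℤ) := by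
  constructor
  · by_contra hneg
    push Not at hneg
    have : (x 0 : ℝ) ≤ -1 := by exact_mod_cast (show x 0 ≤ -1 by omega)
    nlinarith
  · have h1 : a * ((x 0 : ℝ) + 2) ≤ a * (L : ℝ) := by nlinarith
    have h2 : (x 0 : ℝ) + 2 ≤ (L : ℝ) := le_of_mul_le_mul_left h1 ha
    have h3 : ((x 0 + 2 : ℤ) : ℝ) ≤ ((L : ℤ) : ℝ) := by push_cast; exact h2
    exact_mod_cast h3

end Summit.QuantumFields.YangMills.Cruxes.UniversalDetectorPlaneTight

end
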